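import Mathlib.Algebra.Module.Basic
import Mathlib.Algebra.Group.Subgroup.Basic
import Mathlib.GroupTheory.GroupAction.Basic
import Mathlib.Tactic
import HarnessLib

/-!
# Crossed homomorphisms into a Klein four-group are principal off the stabiliser
# (the group-theoretic heart of `H¹(S₃, 𝔽₂²) = 0` as used by the general `2`-descent)

Topic `GroupTheory`; namespace `Literature.GroupTheory.KleinCocycle`. Theorems only (no definition, no named fact,
no `sorry`).

Let a group `G` act by automorphisms on an abelian group `V` which is a Klein four-group
`V = {0, T, T₂, T₃}` (`T + T₂ = T₃`, exponent `2`), WITHOUT non-zero fixed vector (`∀ v ≠ 0, ∃ g, g • v ≠ v`).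
Main result `exists_eq_smul_sub_of_apply_stabilizer`: a crossed homomorphism `φ : G → V`
(`φ(gh) = φ(g) + g • φ(h)`) whose values on the stabiliser `Stab_G(T)` lie in `{0, T}` is PRINCIPAL,
`φ(g) = g • P − P`. Steps: the image of `G` in `Aut V ≅ S₃` is transitive on `{T, T₂, T₃}`
(`exists_smul_eq₁₂`) hence contains a `3`-cycle `s` (`exists_threeCycle`); correcting `φ` by the coboundary of
the `P` with `s • P − P = φ(s)` one may assume `φ(s) = 0`; then for `h ∈ Stab T`,
`φ(h) = φ(hs) ∈ {0, T} ∩ s^j • {0, T} = {0}` (`hs ∈ s^j · Stab T`, `j ∈ {1, 2}`), and `G = ⋃ⱼ s^j · Stab T` gives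
`φ = 0` (`exists_eq_smul_sub_of_threeCycle`). This is the elementary content of `H¹(S₃, 𝔽₂²) = H¹(A₃, 𝔽₂²) = 0`
combined with restriction to an index-`3` stabiliser; it is the group theory behind the injectivity of the general
`2`-descent map `H¹(k, E[2]) → K×/K×²` over the cubic `2`-division field (Cassels, LMSST 24, §15 Lemma 2; sequel
`Literature/NumberTheory/EllipticCurves/TwoDescentOneRootH1Injective.lean`). Seat `bsd-line-spt-p1` (g28).

## References

* [SerreGaloisCohomology1997] J.-P. Serre, *Galois Cohomology*, Springer 1997, I.§2.2, I.§5.1 (cocycles, coboundaries,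
  twisting).
* [Cassels1991LecturesEllipticCurves] J. W. S. Cassels, *Lectures on Elliptic Curves*, LMSST 24, CUP 1991, §15 Lemma 2.
* [SilvermanAEC2009] J. H. Silverman, *The Arithmetic of Elliptic Curves*, 2nd ed. (2009), Prop. X.1.4 (`E[2]` as a
  Galois set).
-/

namespace Literature.GroupTheory.KleinCocycle

variable {G V : Type*} [Group G] [AddCommGroup V] [DistribMulAction G V]

omit [Group G] [DistribMulAction G V] in
/-- `T + T₃ = T₂` in the Klein four-group `{0, T, T₂, T₃ = T + T₂}`. [cite: SerreGaloisCohomology1997, I.§5.1] -/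
theorem klein_add₁₃ {T T₂ T₃ : V} (hadd : T + T₂ = T₃) (hTT : T + T = 0) : T + T₃ = T₂ := by
  rw [← hadd, ← add_assoc, hTT, zero_add]

omit [Group G] [DistribMulAction G V] in
/-- `T₂ + T₃ = T` in the Klein four-group. [cite: SerreGaloisCohomology1997, I.§5.1] -/
theorem klein_add₂₃ {T T₂ T₃ : V} (hadd : T + T₂ = T₃) (h22 : T₂ + T₂ = 0) : T₂ + T₃ = T := by
  rw [← hadd, add_comm T, ← add_assoc, h22, zero_add]

omit [Group G] [DistribMulAction G V] in
/-- `T₃ + T₃ = 0` in the Klein four-group. [cite: SerreGaloisCohomology1997, I.§5.1] -/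
theorem klein_add₃₃ {T T₂ T₃ : V} (hadd : T + T₂ = T₃) (hTT : T + T = 0) (h22 : T₂ + T₂ = 0) :
    T₃ + T₃ = 0 := by
  have : T₃ + T₃ = (T + T) + (T₂ + T₂) := by rw [← hadd]; abel
  rw [this, hTT, h22, add_zero]

omit [Group G] [DistribMulAction G V] in
/-- The Klein four-group has exponent `2`: `-v = v`. [cite: SerreGaloisCohomology1997, I.§5.1] -/
theorem klein_neg {T T₂ T₃ : V} (hadd : T + T₂ = T₃) (hTT : T + T = 0) (h22 : T₂ + T₂ = 0)
    (hall : ∀ v : V, v = 0 ∨ v = T ∨ v = T₂ ∨ v = T₃) (v : V) : -v = v := by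
  rw [neg_eq_iff_add_eq_zero]
  rcases hall v with rfl | rfl | rfl | rfl
  · simp
  · exact hTT
  · exact h22
  · exact klein_add₃₃ hadd hTT h22

omit [Group G] [DistribMulAction G V] in
/-- Subtraction is addition in the Klein four-group. [cite: SerreGaloisCohomology1997, I.§5.1] -/
theorem klein_sub {T T₂ T₃ : V} (hadd : T + T₂ = T₃) (hTT : T + T = 0) (h22 : T₂ + T₂ = 0)
    (hall : ∀ v : V, v = 0 ∨ v = T ∨ v = T₂ ∨ v = T₃) (v w : V) : v - w = v + w := by
  rw [sub_eq_add_neg, klein_neg hadd hTT h22 hall]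

/-- A group acting by automorphisms moves non-zero vectors to non-zero vectors. [cite: SerreGaloisCohomology1997, I.§5.1] -/
theorem smul_ne_zero_of_ne_zero (g : G) {v : V} (hv : v ≠ 0) : g • v ≠ 0 := by
  intro h0
  apply hv
  have := congrArg (fun w => g⁻¹ • w) h0
  simpa using this

/-- **Transitivity**: if no non-zero vector of the Klein four-group `V` is fixed by all of `G`, some `a ∈ G`
maps `T` to `T₂`. [cite: SilvermanAEC2009, Prop. X.1.4 (E[2] as a Galois set)] -/
theorem exists_smul_eq₁₂ {T T₂ T₃ : V} (h0T : T ≠ 0) (h02 : T₂ ≠ 0) (h12 : T ≠ T₂)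
    (hadd : T + T₂ = T₃) (hTT : T + T = 0)
    (hall : ∀ v : V, v = 0 ∨ v = T ∨ v = T₂ ∨ v = T₃)
    (hfix : ∀ v : V, v ≠ 0 → ∃ g : G, g • v ≠ v) : ∃ a : G, a • T = T₂ := by
  have hne0 := fun (g : G) {v : V} (hv : v ≠ 0) => smul_ne_zero_of_ne_zero g hv
  obtain ⟨a₀, ha₀⟩ := hfix T h0T
  rcases hall (a₀ • T) with h | h | h | h
  · exact absurd h (hne0 a₀ h0T)
  · exact absurd h ha₀
  · exact ⟨a₀, h⟩
  -- `a₀ • T = T₃`; use an element moving `T₂`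
  obtain ⟨g₀, hg₀⟩ := hfix T₂ h02
  rcases hall (g₀ • T₂) with e | e | e | e
  · exact absurd e (hne0 g₀ h02)
  · exact ⟨g₀⁻¹, by rw [← e, inv_smul_smul]⟩
  · exact absurd e hg₀
  · -- `g₀ • T₂ = T₃`; then `g₀ • T ∈ {T, T₂}`
    rcases hall (g₀ • T) with f | f | f | f
    · exact absurd f (hne0 g₀ h0T)
    · refine ⟨g₀ * a₀, ?_⟩
      rw [mul_smul, h, ← hadd, smul_add, f, e, klein_add₁₃ hadd hTT]
    · exact ⟨g₀, f⟩
    · exact absurd (smul_left_cancel g₀ (f.trans e.symm)) h12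

/-- **A `3`-cycle exists**: if `G` acts on the Klein four-group `V = {0, T, T₂, T₃}` without non-zero fixed
vector, some `s ∈ G` has `s • T ≠ T` and `s • (s • T) ≠ T` (the image of `G` in `Aut V ≅ S₃` is transitive on
the three non-zero vectors, hence contains `A₃`). [cite: SilvermanAEC2009, Prop. X.1.4 (E[2] as a Galois set)] -/
theorem exists_threeCycle {T T₂ T₃ : V} (h0T : T ≠ 0) (h02 : T₂ ≠ 0) (h03 : T₃ ≠ 0) (h12 : T ≠ T₂)
    (h13 : T ≠ T₃) (hadd : T + T₂ = T₃) (hTT : T + T = 0) (h22 : T₂ + T₂ = 0)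
    (hall : ∀ v : V, v = 0 ∨ v = T ∨ v = T₂ ∨ v = T₃)
    (hfix : ∀ v : V, v ≠ 0 → ∃ g : G, g • v ≠ v) :
    ∃ s : G, s • T ≠ T ∧ s • (s • T) ≠ T := by
  have hne0 := fun (g : G) {v : V} (hv : v ≠ 0) => smul_ne_zero_of_ne_zero g hv
  have h33 : T₃ + T₃ = 0 := klein_add₃₃ hadd hTT h22
  have hadd' : T + T₃ = T₂ := klein_add₁₃ hadd hTT
  have hall' : ∀ v : V, v = 0 ∨ v = T ∨ v = T₃ ∨ v = T₂ := fun v => by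
    rcases hall v with h | h | h | h
    · exact Or.inl h
    · exact Or.inr (Or.inl h)
    · exact Or.inr (Or.inr (Or.inr h))
    · exact Or.inr (Or.inr (Or.inl h))
  obtain ⟨a, ha⟩ := exists_smul_eq₁₂ h0T h02 h12 hadd hTT hall hfix
  obtain ⟨b, hb⟩ := exists_smul_eq₁₂ h0T h03 h13 hadd' hTT hall' hfix
  -- `a • T₂ ∈ {T, T₃}`
  rcases hall (a • T₂) with e | e | e | e
  · exact absurd e (hne0 a h02)
  · -- `a` swaps `T, T₂`; look at `b`: `b • T₃ ∈ {T, T₂}`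
    rcases hall (b • T₃) with f | f | f | f
    · exact absurd f (hne0 b h03)
    · -- `b` swaps `T, T₃`; `a * b` is a 3-cycle: `T ↦ T₃ ↦ T₂`
      have ha3 : a • T₃ = T₃ := by rw [← hadd, smul_add, ha, e, add_comm]
      refine ⟨a * b, ?_, ?_⟩
      · rw [mul_smul, hb, ha3]; exact h13.symm
      · rw [mul_smul, mul_smul, hb, ha3, f, ha]; exact h12.symm
    · exact ⟨b, by rw [hb]; exact h13.symm, by rw [hb, f]; exact h12.symm⟩
    · exact absurd (smul_left_cancel b (f.trans hb.symm)) h13.symm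
  · exact absurd (smul_left_cancel a (e.trans ha.symm)) h12.symm
  · exact ⟨a, by rw [ha]; exact h12.symm, by rw [ha, e]; exact h13.symm⟩

/-- **The normalised case**: given a `3`-cycle `s` (`s • T = T₂`, `s • T₂ = T₃`), a crossed homomorphism
`φ : G → V` with `φ(Stab_G T) ⊆ {0, T}` is principal. [cite: SerreGaloisCohomology1997, I.§5.1 (cocycles, coboundaries)] -/
theorem exists_eq_smul_sub_of_threeCycle {T T₂ T₃ : V} (h0T : T ≠ 0) (h02 : T₂ ≠ 0)
    (h12 : T ≠ T₂) (h13 : T ≠ T₃) (hadd : T + T₂ = T₃) (hTT : T + T = 0)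
    (h22 : T₂ + T₂ = 0) (hall : ∀ v : V, v = 0 ∨ v = T ∨ v = T₂ ∨ v = T₃)
    {s : G} (hs₁ : s • T = T₂) (hs₂ : s • T₂ = T₃)
    (φ : G → V) (hφ : ∀ g h : G, φ (g * h) = φ g + g • φ h)
    (hφH : ∀ h : G, h • T = T → φ h = 0 ∨ φ h = T) :
    ∃ P : V, ∀ g : G, φ g = g • P - P := by
  have hne0 := fun (g : G) {v : V} (hv : v ≠ 0) => smul_ne_zero_of_ne_zero g hv
  have h13' : T + T₃ = T₂ := klein_add₁₃ hadd hTT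
  have h23' : T₂ + T₃ = T := klein_add₂₃ hadd h22
  have hsub := klein_sub hadd hTT h22 hall
  have hs₃ : s • T₃ = T := by rw [← hadd, smul_add, hs₁, hs₂, h23']
  have hsi₂ : s⁻¹ • T₂ = T := by rw [← hs₁, inv_smul_smul]
  have hss₁ : (s * s) • T = T₃ := by rw [mul_smul, hs₁, hs₂]
  have hssi₃ : (s * s)⁻¹ • T₃ = T := by rw [← hss₁, inv_smul_smul]
  -- choose `P` with `s • P - P = φ s`
  obtain ⟨P, hP⟩ : ∃ P : V, s • P - P = φ s := by
    rcases hall (φ s) with h | h | h | h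
    · exact ⟨0, by rw [smul_zero, sub_zero, h]⟩
    · exact ⟨T₂, by rw [hs₂, hsub, add_comm, h23', h]⟩
    · exact ⟨T₃, by rw [hs₃, hsub, h13', h]⟩
    · exact ⟨T, by rw [hs₁, hsub, add_comm, hadd, h]⟩
  -- the adjusted cocycle
  set ψ : G → V := fun g => φ g - (g • P - P) with hψ_def
  have hψ : ∀ g h : G, ψ (g * h) = ψ g + g • ψ h := by
    intro g h
    simp only [hψ_def, hφ g h, mul_smul, smul_sub]
    abel
  have hψs : ψ s = 0 := by simp only [hψ_def, hP, sub_self]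
  have hψss : ψ (s * s) = 0 := by rw [hψ, hψs, smul_zero, add_zero]
  -- `h • P - P ∈ {0, T}` and `ψ h ∈ {0, T}` on the stabiliser of `T`
  have hstabP : ∀ h : G, h • T = T → h • P - P = 0 ∨ h • P - P = T := by
    intro h hT
    rcases hall (h • T₂) with e | e | e | e
    · exact absurd e (hne0 h h02)
    · exact absurd (smul_left_cancel h (e.trans hT.symm)) h12.symm
    · have e3 : h • T₃ = T₃ := by rw [← hadd, smul_add, hT, e]
      left
      rcases hall P with hp | hp | hp | hp <;> rw [hp]
      · rw [smul_zero, sub_zero]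
      · rw [hT, sub_self]
      · rw [e, sub_self]
      · rw [e3, sub_self]
    · have e3 : h • T₃ = T₂ := by rw [← hadd, smul_add, hT, e, h13']
      rcases hall P with hp | hp | hp | hp <;> rw [hp]
      · left; rw [smul_zero, sub_zero]
      · left; rw [hT, sub_self]
      · right; rw [e, hsub, add_comm, h23']
      · right; rw [e3, hsub, h23']
  have hψH : ∀ h : G, h • T = T → ψ h = 0 ∨ ψ h = T := by
    intro h hT
    simp only [hψ_def]
    rcases hφH h hT with e | e <;> rcases hstabP h hT with f | f <;> rw [e, f]
    · left; rw [sub_zero]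
    · right; rw [hsub, zero_add]
    · right; rw [sub_zero]
    · left; rw [hsub, hTT]
  -- KEY: `ψ` vanishes on the stabiliser of `T`
  have hkey : ∀ h : G, h • T = T → ψ h = 0 := by
    intro h hT
    have hhs : ψ (h * s) = ψ h := by rw [hψ, hψs, smul_zero, add_zero]
    rcases hall (h • T₂) with e | e | e | e
    · exact absurd e (hne0 h h02)
    · exact absurd (smul_left_cancel h (e.trans hT.symm)) h12.symm
    · -- `u := s⁻¹ * (h * s)` fixes `T`, `h * s = s * u`
      have hu : (s⁻¹ * (h * s)) • T = T := by rw [mul_smul, mul_smul, hs₁, e, hsi₂]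
      have hfac : h * s = s * (s⁻¹ * (h * s)) := by group
      have hval : ψ (h * s) = s • ψ (s⁻¹ * (h * s)) := by
        conv_lhs => rw [hfac]
        rw [hψ, hψs, zero_add]
      rcases hψH h hT with f | f
      · exact f
      · exfalso
        rw [hhs, f] at hval
        rcases hψH _ hu with f' | f' <;> rw [f'] at hval
        · rw [smul_zero] at hval; exact h0T hval
        · rw [hs₁] at hval; exact h12 hval
    · have hu : ((s * s)⁻¹ * (h * s)) • T = T := by
        rw [mul_smul, mul_smul, hs₁, e, hssi₃]
      have hfac : h * s = (s * s) * ((s * s)⁻¹ * (h * s)) := by group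
      have hval : ψ (h * s) = (s * s) • ψ ((s * s)⁻¹ * (h * s)) := by
        conv_lhs => rw [hfac]
        rw [hψ, hψss, zero_add]
      rcases hψH h hT with f | f
      · exact f
      · exfalso
        rw [hhs, f] at hval
        rcases hψH _ hu with f' | f' <;> rw [f'] at hval
        · rw [smul_zero] at hval; exact h0T hval
        · rw [hss₁] at hval; exact h13 hval
  -- hence `ψ` vanishes everywhere (`G = Stab T ∪ s · Stab T ∪ s² · Stab T`)
  have hzero : ∀ g : G, ψ g = 0 := by
    intro g
    rcases hall (g • T) with e | e | e | e
    · exact absurd e (hne0 g h0T)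
    · exact hkey g e
    · have hu : (s⁻¹ * g) • T = T := by rw [mul_smul, e, hsi₂]
      have hfac : g = s * (s⁻¹ * g) := by group
      rw [hfac, hψ, hψs, zero_add, hkey _ hu, smul_zero]
    · have hu : ((s * s)⁻¹ * g) • T = T := by rw [mul_smul, e, hssi₃]
      have hfac : g = (s * s) * ((s * s)⁻¹ * g) := by group
      rw [hfac, hψ, hψss, zero_add, hkey _ hu, smul_zero]
  refine ⟨P, fun g => ?_⟩
  have := hzero g
  simp only [hψ_def, sub_eq_zero] at this
  exact this

/-- **Main abstract lemma.** A crossed homomorphism `φ : G → V` into a Klein four-group `V = {0, T, T₂, T₃}` on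
which `G` acts by automorphisms WITHOUT non-zero fixed vector, whose values on the stabiliser of `T` lie in
`{0, T}`, is principal (`H¹(S₃, 𝔽₂²) = H¹(A₃, 𝔽₂²) = 0` together with the restriction to the stabiliser).
[cite: SerreGaloisCohomology1997, I.§5.1 (cocycles, coboundaries)] [cite: Cassels1991LecturesEllipticCurves, §15 Lemma 2] -/
theorem exists_eq_smul_sub_of_apply_stabilizer {T T₂ T₃ : V} (h0T : T ≠ 0) (h02 : T₂ ≠ 0)
    (h03 : T₃ ≠ 0) (h12 : T ≠ T₂) (h13 : T ≠ T₃) (hadd : T + T₂ = T₃)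
    (hTT : T + T = 0) (h22 : T₂ + T₂ = 0) (hall : ∀ v : V, v = 0 ∨ v = T ∨ v = T₂ ∨ v = T₃)
    (hfix : ∀ v : V, v ≠ 0 → ∃ g : G, g • v ≠ v)
    (φ : G → V) (hφ : ∀ g h : G, φ (g * h) = φ g + g • φ h)
    (hφH : ∀ h : G, h • T = T → φ h = 0 ∨ φ h = T) :
    ∃ P : V, ∀ g : G, φ g = g • P - P := by
  have hne0 := fun (g : G) {v : V} (hv : v ≠ 0) => smul_ne_zero_of_ne_zero g hv
  have h33 : T₃ + T₃ = 0 := klein_add₃₃ hadd hTT h22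
  have h13' : T + T₃ = T₂ := klein_add₁₃ hadd hTT
  obtain ⟨s, hs₁, hs₂⟩ := exists_threeCycle h0T h02 h03 h12 h13 hadd hTT h22 hall hfix
  rcases hall (s • T) with e | e | e | e
  · exact absurd e (hne0 s h0T)
  · exact absurd e hs₁
  · -- `s • T = T₂`, hence `s • T₂ = T₃`
    have e2 : s • T₂ = T₃ := by
      rcases hall (s • T₂) with f | f | f | f
      · exact absurd f (hne0 s h02)
      · rw [e] at hs₂; exact absurd f hs₂
      · exact absurd (smul_left_cancel s (f.trans e.symm)) h12.symm
      · exact f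
    exact exists_eq_smul_sub_of_threeCycle h0T h02 h12 h13 hadd hTT h22 hall e e2 φ hφ hφH
  · -- `s • T = T₃`, hence `s • T₃ = T₂`: the same with `T₂ ↔ T₃`
    have e3 : s • T₃ = T₂ := by
      rcases hall (s • T₃) with f | f | f | f
      · exact absurd f (hne0 s h03)
      · rw [e] at hs₂; exact absurd f hs₂
      · exact f
      · exact absurd (smul_left_cancel s (f.trans e.symm)) h13.symm
    have hall' : ∀ v : V, v = 0 ∨ v = T ∨ v = T₃ ∨ v = T₂ := fun v => by
      rcases hall v with h | h | h | h
      · exact Or.inl h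
      · exact Or.inr (Or.inl h)
      · exact Or.inr (Or.inr (Or.inr h))
      · exact Or.inr (Or.inr (Or.inl h))
    exact exists_eq_smul_sub_of_threeCycle h0T h03 h13 h12 h13' hTT h33 hall' e e3 φ hφ hφH

end Literature.GroupTheory.KleinCocycle
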